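import Literature.Topology.FourManifolds.Trisections
import Mathlib.Analysis.SpecialFunctions.Sqrt
import Mathlib.Analysis.InnerProductSpace.Calculus
import HarnessLib

/-!
# The corner model of a trisection sector: folding and unbending the quadrant (calculus)

Topic `Literature/Topology/FourManifolds`; infrastructure for the fact seat
`provefact-Literature.Topology.FourManifolds.exists_isBalancedGKTrisection` (Gay–Kirby 2016,
Thm. 4: existence of trisections, over the corrected predicate
`Literature.Topology.FourManifolds.IsGKTrisection` of `Trisections.lean`, whose clause (ii) asks
for *corner charts* `Literature.Topology.FourManifolds.IsCornerAt` of every sector along the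
central surface).  Everything in this file is **proved**; no named facts are introduced.

`Trisections.lean` introduces the polynomial **corner-folding map**
`cornerFold (y₀, y₁, y₂, y₃) = (2 y₀ y₁, y₁² - y₀², y₂, y₃)` (complex squaring
`y₁ + i y₀ ↦ (y₁ + i y₀)²` in the plane normal to the corner stratum `{y₀ = y₁ = 0}`) and its
inverse on the closed half-space `H = {x₀ ≥ 0}`, the **angle-straightening map** ("principal
square root") `cornerUnbend`, with the algebraic identities `cornerFold ∘ cornerUnbend = id` on
`H`, `cornerUnbend ∘ cornerFold = id` on the model quadrant `Q = {y₀ ≥ 0, y₁ ≥ 0}` and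
injectivity of `cornerFold` on `Q`.  Building the smooth atlas of a sector *with its angle
straightened* (Douady–Hérault, "arrondissement des variétés à coins"; part (b) of the section
docstring *Corrected predicate* in `Trisections.lean`, carried out for the round `S⁴` in
`SphereTrisectionsSectors.lean`) needs, beyond these identities, the **topology and the
calculus** of the pair `(cornerFold, cornerUnbend)`, which this file supplies once and for all:

* `continuous_cornerUnbend`; `cornerFoldHomeomorph : Q ≃ₜ H`; the image of a relatively open
  subset of `Q` is relatively open in `H` (`image_cornerFold_inter_cornerQuadrant`:
  `cornerFold '' (U ∩ Q) = cornerUnbend ⁻¹' U ∩ H`) — openness of the targets of corner charts;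
* faces and interior: `cornerFold` maps the face `{y₀ = 0}` of `Q` onto `{x₀ = 0, x₁ ≥ 0}`, the
  face `{y₁ = 0}` onto `{x₀ = 0, x₁ ≤ 0}`, the open quadrant onto the open half-space
  (`cornerFold_apply_zero_pos_iff`), and `ρ(cornerFold y) = y₀² + y₁²` for the radius
  `ρ(x) = √(x₀² + x₁²)` (`cornerRadius_cornerFold`) — boundary points of the straightened sector
  are exactly the points of the two faces;
* **smoothness off the corner stratum.**  `cornerUnbend` is not differentiable along the
  stratum, and along the boundary plane `{x₀ = 0}` one of its two square roots
  `√((ρ ∓ x₁)/2)` has vanishing radicand.  Replacing that square root by its analytic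
  continuation `x₀ / (2 √((ρ ± x₁)/2))` (the branch of the complex square root which is
  holomorphic off the *opposite* ray) gives the smooth maps `cornerUnbendPos`, `cornerUnbendNeg`
  on the open sets `V_± = {ρ ± x₁ > 0}` (`unbendDom (±1)`, covering the complement of the
  stratum), which agree with `cornerUnbend` on `V_± ∩ H` and invert `cornerFold` there:
  `cornerFold` restricts to **diffeomorphisms** `{y₁ > 0} ≅ V₊` and `{y₀ > 0} ≅ V₋`
  (`cornerFoldPosChart`, `cornerFoldNegChart`: open partial homeomorphisms of `ℝ⁴` with
  `C^∞` inverse, `contDiffOn_cornerFoldPosChart_symm`).  Consequently `cornerUnbend` is `C^∞`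
  at every point with `x₀ ≠ 0` (`contDiffAt_cornerUnbend`) and `C^∞` *within the half-space*
  at every point of `H` off the stratum (`contDiffWithinAt_cornerUnbend`,
  `contDiffOn_cornerUnbend`) — smoothness of the transition maps between a corner chart and a
  face or interior chart of a straightened sector.

These are the standard properties of the squaring map `z ↦ z²` between the closed first
quadrant and the closed upper half-plane used to straighten the angle of a manifold with
corners of index `2` (Douady 1961/62, §4; Douady–Hérault 1973, Appendice), written out for the
tree's explicit maps.

## References

* A. Douady, *Variétés à bord anguleux et voisinages tubulaires*, Séminaire H. Cartan 14
  (1961/62), exp. 1, §1 and §4. [Douady1961]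
* A. Douady, L. Hérault, *Arrondissement des variétés à coins*, appendix to A. Borel,
  J.-P. Serre, *Corners and arithmetic groups*, Comment. Math. Helv. 48 (1973) 436–491.
  [DouadyHerault1973]
* D. Gay, R. Kirby, *Trisecting 4-manifolds*, Geom. Topol. 20 (2016) 3097–3132
  (arXiv:1205.1565), Def. 1 and Fig. 1 (sectors with corners along the central surface).
  [GayKirby2016]
-/

open scoped ContDiff Topology
open Set Function

noncomputable section

namespace Literature.Topology.FourManifolds

/-- Local notation: `𝔼⁴` is the model vector space `EuclideanSpace ℝ (Fin 4)`. -/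
local notation "𝔼⁴" => EuclideanSpace ℝ (Fin 4)

/-- The coordinate functions of `ℝ⁴` are smooth. [folklore] -/
private theorem contDiff_coord (i : Fin 4) : ContDiff ℝ ∞ fun x : 𝔼⁴ => x i :=
  contDiff_euclidean.mp contDiff_id i

/-- The coordinate functions of `ℝ⁴` are continuous. [folklore] -/
private theorem continuous_coord (i : Fin 4) : Continuous fun x : 𝔼⁴ => x i :=
  (contDiff_coord i).continuous

/-! ### Continuity of folding and unbending; the normal radius -/

/-- `cornerFold` is continuous. [cite: DouadyHerault1973, Appendice] -/
theorem continuous_cornerFold : Continuous cornerFold :=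
  contDiff_cornerFold.continuous

/-- The **normal radius** `ρ(x) = √(x₀² + x₁²)`: the modulus of `x₁ + i x₀` in the plane normal to
the corner stratum `{x₀ = x₁ = 0}`. [cite: DouadyHerault1973, Appendice] -/
def cornerRadius (x : 𝔼⁴) : ℝ := √(x 0 ^ 2 + x 1 ^ 2)

/-- `ρ ≥ 0`. [folklore] -/
theorem cornerRadius_nonneg (x : 𝔼⁴) : 0 ≤ cornerRadius x := Real.sqrt_nonneg _

/-- `ρ² = x₀² + x₁²`. [folklore] -/
theorem cornerRadius_sq (x : 𝔼⁴) : cornerRadius x ^ 2 = x 0 ^ 2 + x 1 ^ 2 :=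
  Real.sq_sqrt (by positivity)

/-- `|x₁| ≤ ρ`. [folklore] -/
theorem abs_apply_one_le_cornerRadius (x : 𝔼⁴) : |x 1| ≤ cornerRadius x := by
  rw [← Real.sqrt_sq_eq_abs]
  exact Real.sqrt_le_sqrt (by nlinarith [sq_nonneg (x 0)])

/-- `|x₀| ≤ ρ`. [folklore] -/
theorem abs_apply_zero_le_cornerRadius (x : 𝔼⁴) : |x 0| ≤ cornerRadius x := by
  rw [← Real.sqrt_sq_eq_abs]
  exact Real.sqrt_le_sqrt (by nlinarith [sq_nonneg (x 1)])

/-- `ρ = 0` exactly on the corner stratum. [folklore] -/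
theorem cornerRadius_eq_zero_iff (x : 𝔼⁴) : cornerRadius x = 0 ↔ x 0 = 0 ∧ x 1 = 0 := by
  constructor
  · intro h
    have hsq := cornerRadius_sq x
    rw [h] at hsq
    constructor <;> nlinarith [sq_nonneg (x 0), sq_nonneg (x 1)]
  · rintro ⟨h0, h1⟩
    simp [cornerRadius, h0, h1]

/-- `ρ > 0` exactly off the corner stratum. [folklore] -/
theorem cornerRadius_pos_iff (x : 𝔼⁴) : 0 < cornerRadius x ↔ (x 0 ≠ 0 ∨ x 1 ≠ 0) := by
  rw [(cornerRadius_nonneg x).lt_iff_ne', ne_eq, cornerRadius_eq_zero_iff, not_and_or]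

/-- `x₀ ≠ 0` forces `|x₁| < ρ`. [folklore] -/
theorem abs_apply_one_lt_cornerRadius {x : 𝔼⁴} (h : x 0 ≠ 0) : |x 1| < cornerRadius x := by
  rw [← Real.sqrt_sq_eq_abs]
  exact Real.sqrt_lt_sqrt (sq_nonneg _) (by nlinarith [sq_pos_of_ne_zero h])

/-- `ρ` is continuous. [folklore] -/
theorem continuous_cornerRadius : Continuous cornerRadius :=
  Real.continuous_sqrt.comp (((continuous_coord 0).pow 2).add ((continuous_coord 1).pow 2))

/-- `ρ` is smooth off the corner stratum. [folklore] -/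
theorem contDiffAt_cornerRadius {x : 𝔼⁴} (h : x 0 ≠ 0 ∨ x 1 ≠ 0) :
    ContDiffAt ℝ ∞ cornerRadius x := by
  have hpos : 0 < x 0 ^ 2 + x 1 ^ 2 := by
    rcases h with h | h
    · nlinarith [sq_pos_of_ne_zero h, sq_nonneg (x 1)]
    · nlinarith [sq_pos_of_ne_zero h, sq_nonneg (x 0)]
  exact (((contDiff_coord 0).pow 2).add ((contDiff_coord 1).pow 2)).contDiffAt.sqrt hpos.ne'

/-- `ρ` is smooth on the complement of the corner stratum. [folklore] -/
theorem contDiffOn_cornerRadius : ContDiffOn ℝ ∞ cornerRadius {x : 𝔼⁴ | x 0 ≠ 0 ∨ x 1 ≠ 0} :=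
  fun _ hx => (contDiffAt_cornerRadius hx).contDiffWithinAt

/-- First coordinate of `cornerUnbend` in terms of the normal radius: `√((ρ - x₁)/2)`.
[cite: DouadyHerault1973, Appendice] -/
theorem cornerUnbend_apply_zero' (x : 𝔼⁴) : cornerUnbend x 0 = √((cornerRadius x - x 1) / 2) :=
  rfl

/-- Second coordinate of `cornerUnbend` in terms of the normal radius: `√((ρ + x₁)/2)`.
[cite: DouadyHerault1973, Appendice] -/
theorem cornerUnbend_apply_one' (x : 𝔼⁴) : cornerUnbend x 1 = √((cornerRadius x + x 1) / 2) :=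
  rfl

/-- `cornerUnbend` is continuous (square roots of continuous nonnegative functions).
[cite: DouadyHerault1973, Appendice] -/
theorem continuous_cornerUnbend : Continuous cornerUnbend := by
  have h : ∀ i, Continuous fun x => cornerUnbend x i := by
    intro i
    fin_cases i
    · exact Real.continuous_sqrt.comp ((continuous_cornerRadius.sub (continuous_coord 1)).div_const _)
    · exact Real.continuous_sqrt.comp ((continuous_cornerRadius.add (continuous_coord 1)).div_const _)
    · exact continuous_coord 2
    · exact continuous_coord 3
  have h' : Continuous (fun x => WithLp.ofLp (cornerUnbend x)) := continuous_pi h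
  exact (PiLp.continuous_toLp 2 _).comp h'

/-- The radial identity `y₀² + y₁² = ρ(x)` for `y = cornerUnbend x` (`|√z|² = |z|`).
[cite: DouadyHerault1973, Appendice] -/
theorem cornerUnbend_sq_add_sq (x : 𝔼⁴) :
    cornerUnbend x 0 ^ 2 + cornerUnbend x 1 ^ 2 = cornerRadius x := by
  have h1 : 0 ≤ (cornerRadius x - x 1) / 2 := by
    linarith [le_abs_self (x 1), abs_apply_one_le_cornerRadius x]
  have h2 : 0 ≤ (cornerRadius x + x 1) / 2 := by
    linarith [neg_abs_le (x 1), abs_apply_one_le_cornerRadius x]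
  rw [cornerUnbend_apply_zero', cornerUnbend_apply_one', Real.sq_sqrt h1, Real.sq_sqrt h2]
  ring

/-! ### Folding the quadrant: radius, faces and interior -/

/-- `ρ(cornerFold y) = y₀² + y₁²` (`|z²| = |z|²`). [cite: DouadyHerault1973, Appendice] -/
theorem cornerRadius_cornerFold (y : 𝔼⁴) : cornerRadius (cornerFold y) = y 0 ^ 2 + y 1 ^ 2 := by
  rw [cornerRadius, cornerFold_apply_zero, cornerFold_apply_one,
    show (2 * y 0 * y 1) ^ 2 + (y 1 ^ 2 - y 0 ^ 2) ^ 2 = (y 0 ^ 2 + y 1 ^ 2) ^ 2 by ring,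
    Real.sqrt_sq (by positivity)]

/-- The folded point lies on the boundary plane `{x₀ = 0}` exactly when `y` lies on one of the
two coordinate hyperplanes `{y₀ = 0}`, `{y₁ = 0}` (the faces of the quadrant).
[cite: Douady1961, §1 and §4] -/
theorem cornerFold_apply_zero_eq_zero_iff (y : 𝔼⁴) : cornerFold y 0 = 0 ↔ y 0 = 0 ∨ y 1 = 0 := by
  rw [cornerFold_apply_zero, mul_assoc, mul_eq_zero, mul_eq_zero]
  simp

/-- On the quadrant, the folded point lies in the open half-space `{x₀ > 0}` exactly when `y`
lies in the open quadrant. [cite: Douady1961, §1 and §4] -/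
theorem cornerFold_apply_zero_pos_iff {y : 𝔼⁴} (hy : y ∈ cornerQuadrant) :
    0 < cornerFold y 0 ↔ 0 < y 0 ∧ 0 < y 1 := by
  rw [cornerFold_apply_zero]
  refine ⟨fun h => ?_, fun h => mul_pos (mul_pos two_pos h.1) h.2⟩
  rcases hy.1.lt_or_eq with h0 | h0
  · rcases hy.2.lt_or_eq with h1 | h1
    · exact ⟨h0, h1⟩
    · rw [← h1] at h; simp at h
  · rw [← h0] at h; simp at h

/-- The face `{y₀ = 0}` is folded onto the closed ray `{x₀ = 0, x₁ ≥ 0}`: `x₁ = y₁²`.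
[cite: Douady1961, §1 and §4] -/
theorem cornerFold_apply_one_of_apply_zero_eq_zero {y : 𝔼⁴} (h : y 0 = 0) :
    cornerFold y 1 = y 1 ^ 2 := by
  simp [h]

/-- The face `{y₁ = 0}` is folded onto the closed ray `{x₀ = 0, x₁ ≤ 0}`: `x₁ = -y₀²`.
[cite: Douady1961, §1 and §4] -/
theorem cornerFold_apply_one_of_apply_one_eq_zero {y : 𝔼⁴} (h : y 1 = 0) :
    cornerFold y 1 = -(y 0 ^ 2) := by
  simp [h]

/-- Unbending a point of the closed ray `{x₀ = 0, x₁ ≥ 0}` gives the point `(0, √x₁, x₂, x₃)` of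
the face `{y₀ = 0}`. [cite: Douady1961, §1 and §4] -/
theorem cornerUnbend_of_apply_zero_eq_zero_of_nonneg {x : 𝔼⁴} (h0 : x 0 = 0) (h1 : 0 ≤ x 1) :
    cornerUnbend x = !₂[0, √(x 1), x 2, x 3] := by
  have hρ : cornerRadius x = x 1 := by
    rw [cornerRadius, h0, show (0 : ℝ) ^ 2 + x 1 ^ 2 = x 1 ^ 2 by ring, Real.sqrt_sq h1]
  ext i
  fin_cases i
  · show cornerUnbend x 0 = 0
    rw [cornerUnbend_apply_zero', hρ, sub_self, zero_div, Real.sqrt_zero]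
  · show cornerUnbend x 1 = √(x 1)
    rw [cornerUnbend_apply_one', hρ]
    congr 1; ring
  · rfl
  · rfl

/-- Unbending a point of the closed ray `{x₀ = 0, x₁ ≤ 0}` gives the point `(√(-x₁), 0, x₂, x₃)`
of the face `{y₁ = 0}`. [cite: Douady1961, §1 and §4] -/
theorem cornerUnbend_of_apply_zero_eq_zero_of_nonpos {x : 𝔼⁴} (h0 : x 0 = 0) (h1 : x 1 ≤ 0) :
    cornerUnbend x = !₂[√(-x 1), 0, x 2, x 3] := by
  have hρ : cornerRadius x = -x 1 := by
    rw [cornerRadius, h0, show (0 : ℝ) ^ 2 + x 1 ^ 2 = (-x 1) ^ 2 by ring,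
      Real.sqrt_sq (by linarith)]
  ext i
  fin_cases i
  · show cornerUnbend x 0 = √(-x 1)
    rw [cornerUnbend_apply_zero', hρ]
    congr 1; ring
  · show cornerUnbend x 1 = 0
    rw [cornerUnbend_apply_one', hρ, neg_add_cancel, zero_div, Real.sqrt_zero]
  · rfl
  · rfl

/-- On the half-space, the unbent point lies in the open quadrant exactly when `x₀ > 0`.
[cite: Douady1961, §1 and §4] -/
theorem cornerUnbend_pos_iff {x : 𝔼⁴} (hx : 0 ≤ x 0) :
    (0 < cornerUnbend x 0 ∧ 0 < cornerUnbend x 1) ↔ 0 < x 0 := by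
  rw [← cornerFold_apply_zero_pos_iff (cornerUnbend_mem_cornerQuadrant x),
    cornerFold_cornerUnbend hx]

/-- On the half-space, the unbent point lies on a face of the quadrant exactly when `x₀ = 0`.
[cite: Douady1961, §1 and §4] -/
theorem cornerUnbend_apply_eq_zero_iff {x : 𝔼⁴} (hx : 0 ≤ x 0) :
    (cornerUnbend x 0 = 0 ∨ cornerUnbend x 1 = 0) ↔ x 0 = 0 := by
  rw [← cornerFold_apply_zero_eq_zero_iff, cornerFold_cornerUnbend hx]

/-! ### The quadrant folds homeomorphically onto the half-space -/

/-- `cornerFold(Q) = H`: the quadrant is folded exactly onto the closed half-space `{x₀ ≥ 0}`.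
[cite: DouadyHerault1973, Appendice] -/
theorem image_cornerFold_cornerQuadrant : cornerFold '' cornerQuadrant = {x : 𝔼⁴ | 0 ≤ x 0} := by
  refine Subset.antisymm ?_ fun x hx => ?_
  · rintro _ ⟨y, hy, rfl⟩
    exact cornerFold_apply_zero_nonneg hy
  · exact ⟨cornerUnbend x, cornerUnbend_mem_cornerQuadrant x, cornerFold_cornerUnbend hx⟩

/-- `cornerUnbend(H) = Q`. [cite: DouadyHerault1973, Appendice] -/
theorem image_cornerUnbend_halfSpace : cornerUnbend '' {x : 𝔼⁴ | 0 ≤ x 0} = cornerQuadrant := by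
  refine Subset.antisymm ?_ fun y hy => ?_
  · rintro _ ⟨x, -, rfl⟩
    exact cornerUnbend_mem_cornerQuadrant x
  · exact ⟨cornerFold y, cornerFold_apply_zero_nonneg hy, cornerUnbend_cornerFold hy⟩

/-- `cornerUnbend` maps the half-space into the quadrant. [cite: DouadyHerault1973, Appendice] -/
theorem mapsTo_cornerUnbend : MapsTo cornerUnbend {x : 𝔼⁴ | 0 ≤ x 0} cornerQuadrant :=
  fun x _ => cornerUnbend_mem_cornerQuadrant x

/-- `cornerFold` maps the quadrant into the half-space. [cite: DouadyHerault1973, Appendice] -/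
theorem mapsTo_cornerFold : MapsTo cornerFold cornerQuadrant {x : 𝔼⁴ | 0 ≤ x 0} :=
  fun _ hy => cornerFold_apply_zero_nonneg hy

/-- For a point `x` of the half-space and any `U ⊆ ℝ⁴`: `x ∈ cornerFold(U ∩ Q) ↔ cornerUnbend x ∈ U`.
[cite: DouadyHerault1973, Appendice] -/
theorem mem_image_cornerFold_inter_iff (U : Set 𝔼⁴) {x : 𝔼⁴} (hx : 0 ≤ x 0) :
    x ∈ cornerFold '' (U ∩ cornerQuadrant) ↔ cornerUnbend x ∈ U := by
  constructor
  · rintro ⟨y, ⟨hyU, hyQ⟩, rfl⟩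
    rwa [cornerUnbend_cornerFold hyQ]
  · intro h
    exact ⟨cornerUnbend x, ⟨h, cornerUnbend_mem_cornerQuadrant x⟩, cornerFold_cornerUnbend hx⟩

/-- **Relatively open sets go to relatively open sets.** `cornerFold (U ∩ Q) = cornerUnbend⁻¹(U) ∩ H`;
for `U` open the right-hand side is the trace on `H` of an open set (`continuous_cornerUnbend`),
which is the openness of the target of a corner chart of a straightened sector.
[cite: DouadyHerault1973, Appendice] -/
theorem image_cornerFold_inter_cornerQuadrant (U : Set 𝔼⁴) :
    cornerFold '' (U ∩ cornerQuadrant) = cornerUnbend ⁻¹' U ∩ {x : 𝔼⁴ | 0 ≤ x 0} := by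
  ext x
  constructor
  · intro h
    have hx : 0 ≤ x 0 := by
      obtain ⟨y, ⟨-, hyQ⟩, rfl⟩ := h
      exact cornerFold_apply_zero_nonneg hyQ
    exact ⟨(mem_image_cornerFold_inter_iff U hx).1 h, hx⟩
  · rintro ⟨hU, hx⟩
    exact (mem_image_cornerFold_inter_iff U hx).2 hU

/-- Dually, `cornerUnbend (V ∩ H) = cornerFold⁻¹(V) ∩ Q`. [cite: DouadyHerault1973, Appendice] -/
theorem image_cornerUnbend_inter_halfSpace (V : Set 𝔼⁴) :
    cornerUnbend '' (V ∩ {x : 𝔼⁴ | 0 ≤ x 0}) = cornerFold ⁻¹' V ∩ cornerQuadrant := by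
  ext y
  constructor
  · rintro ⟨x, ⟨hxV, hx⟩, rfl⟩
    exact ⟨by rwa [mem_preimage, cornerFold_cornerUnbend hx], cornerUnbend_mem_cornerQuadrant x⟩
  · rintro ⟨hV, hyQ⟩
    exact ⟨cornerFold y, ⟨hV, cornerFold_apply_zero_nonneg hyQ⟩, cornerUnbend_cornerFold hyQ⟩

/-- If `U` is open then `cornerFold (U ∩ Q)` is the trace on the half-space of an open set.
[cite: DouadyHerault1973, Appendice] -/
theorem exists_isOpen_image_cornerFold_inter {U : Set 𝔼⁴} (hU : IsOpen U) :
    ∃ V : Set 𝔼⁴, IsOpen V ∧ cornerFold '' (U ∩ cornerQuadrant) = V ∩ {x : 𝔼⁴ | 0 ≤ x 0} :=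
  ⟨cornerUnbend ⁻¹' U, hU.preimage continuous_cornerUnbend, image_cornerFold_inter_cornerQuadrant U⟩

/-- **The quadrant folds homeomorphically onto the half-space**: `cornerFold : Q ≃ₜ H` with
inverse `cornerUnbend` (complex squaring from the closed first quadrant onto the closed upper
half-plane). [cite: DouadyHerault1973, Appendice] -/
def cornerFoldHomeomorph : cornerQuadrant ≃ₜ {x : 𝔼⁴ | 0 ≤ x 0} where
  toFun y := ⟨cornerFold y, cornerFold_apply_zero_nonneg y.2⟩
  invFun x := ⟨cornerUnbend x, cornerUnbend_mem_cornerQuadrant x⟩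
  left_inv y := Subtype.ext (cornerUnbend_cornerFold y.2)
  right_inv x := Subtype.ext (cornerFold_cornerUnbend x.2)
  continuous_toFun := (continuous_cornerFold.comp continuous_subtype_val).subtype_mk _
  continuous_invFun := (continuous_cornerUnbend.comp continuous_subtype_val).subtype_mk _

/-- `cornerFoldHomeomorph` is `cornerFold` on points. [cite: DouadyHerault1973, Appendice] -/
@[simp] theorem cornerFoldHomeomorph_apply_coe (y : cornerQuadrant) :
    (cornerFoldHomeomorph y : 𝔼⁴) = cornerFold y := rfl

/-- The inverse of `cornerFoldHomeomorph` is `cornerUnbend` on points.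
[cite: DouadyHerault1973, Appendice] -/
@[simp] theorem cornerFoldHomeomorph_symm_apply_coe (x : {x : 𝔼⁴ | 0 ≤ x 0}) :
    (cornerFoldHomeomorph.symm x : 𝔼⁴) = cornerUnbend x := rfl

/-! ### Smooth unbending off the corner stratum

Along the boundary plane `{x₀ = 0}` one of the two square roots in `cornerUnbend` has vanishing
radicand; we continue it analytically.  For `σ = ±1` put `P_σ = √((ρ + σ x₁)/2)` and
`R_σ = x₀ / (2 P_σ)` on the open set `V_σ = {ρ + σ x₁ > 0}`.  On `V₊ ∩ H` one has
`(y₀, y₁) = (R₊, P₊)` and on `V₋ ∩ H` one has `(y₀, y₁) = (P₋, R₋)` for `y = cornerUnbend x`. -/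

/-- The open set `V_σ = {ρ + σ x₁ > 0}` (`σ = ±1`): the complement of the closed ray
`{x₀ = 0, σ x₁ ≤ 0}` of the normal plane, times the corner stratum directions.
[cite: DouadyHerault1973, Appendice] -/
def unbendDom (σ : ℝ) : Set 𝔼⁴ := {x | 0 < cornerRadius x + σ * x 1}

/-- Membership in `V_σ` (definitional). [folklore] -/
theorem mem_unbendDom_iff {σ : ℝ} {x : 𝔼⁴} : x ∈ unbendDom σ ↔ 0 < cornerRadius x + σ * x 1 :=
  Iff.rfl

/-- `V_σ` is open. [folklore] -/
theorem isOpen_unbendDom (σ : ℝ) : IsOpen (unbendDom σ) :=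
  isOpen_lt continuous_const (continuous_cornerRadius.add (continuous_const.mul (continuous_coord 1)))

/-- Points with `x₀ ≠ 0` lie in both `V₊` and `V₋` (`|x₁| < ρ`). [folklore] -/
theorem mem_unbendDom_of_apply_zero_ne_zero {σ : ℝ} (hσ : σ = 1 ∨ σ = -1) {x : 𝔼⁴}
    (h : x 0 ≠ 0) : x ∈ unbendDom σ := by
  have hlt := abs_apply_one_lt_cornerRadius h
  rw [mem_unbendDom_iff]
  rcases hσ with rfl | rfl
  · linarith [neg_abs_le (x 1)]
  · linarith [le_abs_self (x 1)]

/-- On the boundary plane `{x₀ = 0}`: `x ∈ V₊ ↔ x₁ > 0`. [folklore] -/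
theorem mem_unbendDom_one_iff_of_apply_zero_eq_zero {x : 𝔼⁴} (h : x 0 = 0) :
    x ∈ unbendDom 1 ↔ 0 < x 1 := by
  have hρ : cornerRadius x = |x 1| := by
    rw [cornerRadius, h, show (0 : ℝ) ^ 2 + x 1 ^ 2 = x 1 ^ 2 by ring, Real.sqrt_sq_eq_abs]
  rw [mem_unbendDom_iff, hρ, one_mul]
  constructor
  · intro hx
    by_contra hle
    rw [not_lt] at hle
    rw [abs_of_nonpos hle] at hx
    linarith
  · intro hx
    rw [abs_of_pos hx]; linarith

/-- On the boundary plane `{x₀ = 0}`: `x ∈ V₋ ↔ x₁ < 0`. [folklore] -/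
theorem mem_unbendDom_neg_one_iff_of_apply_zero_eq_zero {x : 𝔼⁴} (h : x 0 = 0) :
    x ∈ unbendDom (-1) ↔ x 1 < 0 := by
  have hρ : cornerRadius x = |x 1| := by
    rw [cornerRadius, h, show (0 : ℝ) ^ 2 + x 1 ^ 2 = x 1 ^ 2 by ring, Real.sqrt_sq_eq_abs]
  rw [mem_unbendDom_iff, hρ, neg_one_mul]
  constructor
  · intro hx
    by_contra hle
    rw [not_lt] at hle
    rw [abs_of_nonneg hle] at hx
    linarith
  · intro hx
    rw [abs_of_neg hx]; linarith

/-- `V₊ ∪ V₋` is the complement of the corner stratum. [cite: DouadyHerault1973, Appendice] -/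
theorem unbendDom_one_union_unbendDom_neg_one :
    unbendDom 1 ∪ unbendDom (-1) = {x : 𝔼⁴ | x 0 ≠ 0 ∨ x 1 ≠ 0} := by
  ext x
  simp only [mem_union, mem_setOf_eq]
  constructor
  · rintro (hx | hx)
    · by_contra hc
      simp only [not_or, not_not] at hc
      rw [mem_unbendDom_one_iff_of_apply_zero_eq_zero hc.1, hc.2] at hx
      exact lt_irrefl _ hx
    · by_contra hc
      simp only [not_or, not_not] at hc
      rw [mem_unbendDom_neg_one_iff_of_apply_zero_eq_zero hc.1, hc.2] at hx
      exact lt_irrefl _ hx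
  · intro hx
    by_cases h0 : x 0 = 0
    · have h1 : x 1 ≠ 0 := hx.resolve_left (not_not.mpr h0)
      rcases lt_or_gt_of_ne h1 with h1 | h1
      · exact Or.inr ((mem_unbendDom_neg_one_iff_of_apply_zero_eq_zero h0).2 h1)
      · exact Or.inl ((mem_unbendDom_one_iff_of_apply_zero_eq_zero h0).2 h1)
    · exact Or.inl (mem_unbendDom_of_apply_zero_ne_zero (Or.inl rfl) h0)

/-- Off the corner stratum, every point lies in `V₊` or in `V₋`. [cite: DouadyHerault1973, Appendice] -/
theorem mem_unbendDom_or {x : 𝔼⁴} (hx : x 0 ≠ 0 ∨ x 1 ≠ 0) :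
    x ∈ unbendDom 1 ∨ x ∈ unbendDom (-1) := by
  have : x ∈ unbendDom 1 ∪ unbendDom (-1) := by
    rw [unbendDom_one_union_unbendDom_neg_one]; exact hx
  exact this

/-- `V_σ` avoids the corner stratum (`σ = ±1`). [folklore] -/
theorem apply_ne_zero_of_mem_unbendDom {σ : ℝ} (hσ : σ = 1 ∨ σ = -1) {x : 𝔼⁴}
    (hx : x ∈ unbendDom σ) : x 0 ≠ 0 ∨ x 1 ≠ 0 := by
  have hx' : x ∈ unbendDom 1 ∪ unbendDom (-1) := by
    rcases hσ with rfl | rfl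
    · exact Or.inl hx
    · exact Or.inr hx
  rwa [unbendDom_one_union_unbendDom_neg_one] at hx'

/-- `ρ` is smooth on `V_σ`. [folklore] -/
theorem contDiffOn_cornerRadius_unbendDom {σ : ℝ} (hσ : σ = 1 ∨ σ = -1) :
    ContDiffOn ℝ ∞ cornerRadius (unbendDom σ) :=
  contDiffOn_cornerRadius.mono fun _ hx => apply_ne_zero_of_mem_unbendDom hσ hx

/-- `P_σ = √((ρ + σ x₁)/2)`: for `σ = 1` the coordinate `y₁`, for `σ = -1` the coordinate `y₀`
of `cornerUnbend`. [cite: DouadyHerault1973, Appendice] -/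
def unbendP (σ : ℝ) (x : 𝔼⁴) : ℝ := √((cornerRadius x + σ * x 1) / 2)

/-- `R_σ = x₀ / (2 P_σ)`: the analytic continuation across `{x₀ = 0} ∩ V_σ` of the other
coordinate (`y₀` for `σ = 1`, `y₁` for `σ = -1`). [cite: DouadyHerault1973, Appendice] -/
def unbendR (σ : ℝ) (x : 𝔼⁴) : ℝ := x 0 / (2 * unbendP σ x)

/-- `P₊ = y₁`. [cite: DouadyHerault1973, Appendice] -/
theorem unbendP_one (x : 𝔼⁴) : unbendP 1 x = cornerUnbend x 1 := by
  rw [unbendP, cornerUnbend_apply_one', one_mul]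

/-- `P₋ = y₀`. [cite: DouadyHerault1973, Appendice] -/
theorem unbendP_neg_one (x : 𝔼⁴) : unbendP (-1) x = cornerUnbend x 0 := by
  rw [unbendP, cornerUnbend_apply_zero', neg_one_mul, sub_eq_add_neg]

section UnbendScalars

variable {σ : ℝ} {x : 𝔼⁴}

/-- `P_σ > 0` on `V_σ`. [folklore] -/
theorem unbendP_pos (hx : x ∈ unbendDom σ) : 0 < unbendP σ x :=
  Real.sqrt_pos.2 (half_pos (mem_unbendDom_iff.1 hx))

/-- `P_σ² = (ρ + σ x₁)/2` on `V_σ`. [folklore] -/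
theorem unbendP_sq (hx : x ∈ unbendDom σ) : unbendP σ x ^ 2 = (cornerRadius x + σ * x 1) / 2 :=
  Real.sq_sqrt (half_pos (mem_unbendDom_iff.1 hx)).le

/-- `2 P_σ R_σ = x₀` on `V_σ` (definition of `R_σ`). [folklore] -/
theorem two_mul_unbendP_mul_unbendR (hx : x ∈ unbendDom σ) :
    2 * unbendP σ x * unbendR σ x = x 0 := by
  rw [unbendR]; field_simp [(unbendP_pos hx).ne']

/-- `R_σ² = (ρ - σ x₁)/2` on `V_σ`, because `x₀² = ρ² - x₁² = (ρ + σ x₁)(ρ - σ x₁)`.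
[folklore] -/
theorem unbendR_sq (hσ : σ = 1 ∨ σ = -1) (hx : x ∈ unbendDom σ) :
    unbendR σ x ^ 2 = (cornerRadius x - σ * x 1) / 2 := by
  have hP := unbendP_pos hx
  have hP2 := unbendP_sq hx
  have hρ := cornerRadius_sq x
  have hσ2 : σ ^ 2 = 1 := by rcases hσ with rfl | rfl <;> norm_num
  have h4 : (2 * unbendP σ x) ^ 2 * unbendR σ x ^ 2 = x 0 ^ 2 := by
    rw [← mul_pow, two_mul_unbendP_mul_unbendR hx]
  have hkey : x 0 ^ 2 = (cornerRadius x + σ * x 1) * (cornerRadius x - σ * x 1) := by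
    have : (cornerRadius x + σ * x 1) * (cornerRadius x - σ * x 1) =
        cornerRadius x ^ 2 - σ ^ 2 * x 1 ^ 2 := by ring
    rw [this, hσ2, hρ]; ring
  have hne : (2 * unbendP σ x) ^ 2 ≠ 0 := by positivity
  have hpos : 0 < cornerRadius x + σ * x 1 := hx
  calc unbendR σ x ^ 2 = x 0 ^ 2 / (2 * unbendP σ x) ^ 2 := by
        rw [eq_div_iff hne, mul_comm, h4]
    _ = (cornerRadius x - σ * x 1) * (cornerRadius x + σ * x 1) /
          (2 * (cornerRadius x + σ * x 1)) := by
        rw [hkey, mul_pow, hP2]; ring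
    _ = (cornerRadius x - σ * x 1) / 2 := mul_div_mul_right _ _ hpos.ne'

/-- `P_σ² + R_σ² = ρ` on `V_σ`. [folklore] -/
theorem unbendP_sq_add_unbendR_sq (hσ : σ = 1 ∨ σ = -1) (hx : x ∈ unbendDom σ) :
    unbendP σ x ^ 2 + unbendR σ x ^ 2 = cornerRadius x := by
  rw [unbendP_sq hx, unbendR_sq hσ hx]; ring

/-- `P_σ² - R_σ² = σ x₁` on `V_σ`. [folklore] -/
theorem unbendP_sq_sub_unbendR_sq (hσ : σ = 1 ∨ σ = -1) (hx : x ∈ unbendDom σ) :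
    unbendP σ x ^ 2 - unbendR σ x ^ 2 = σ * x 1 := by
  rw [unbendP_sq hx, unbendR_sq hσ hx]; ring

/-- On the half-space `R_σ ≥ 0` (on `V_σ`). [folklore] -/
theorem unbendR_nonneg (hx : x ∈ unbendDom σ) (h0 : 0 ≤ x 0) : 0 ≤ unbendR σ x :=
  div_nonneg h0 (mul_pos two_pos (unbendP_pos hx)).le

end UnbendScalars

/-- `P_σ` is smooth on `V_σ` (square root of a positive smooth function). [folklore] -/
theorem contDiffOn_unbendP {σ : ℝ} (hσ : σ = 1 ∨ σ = -1) : ContDiffOn ℝ ∞ (unbendP σ) (unbendDom σ) := by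
  refine ContDiffOn.sqrt ?_ fun x hx => (half_pos (mem_unbendDom_iff.1 hx)).ne'
  exact ((contDiffOn_cornerRadius_unbendDom hσ).add
    (contDiffOn_const.mul (contDiff_coord 1).contDiffOn)).div_const _

/-- `R_σ` is smooth on `V_σ`. [folklore] -/
theorem contDiffOn_unbendR {σ : ℝ} (hσ : σ = 1 ∨ σ = -1) : ContDiffOn ℝ ∞ (unbendR σ) (unbendDom σ) :=
  (contDiff_coord 0).contDiffOn.div (contDiffOn_const.mul (contDiffOn_unbendP hσ))
    fun _ hx => (mul_pos two_pos (unbendP_pos hx)).ne'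

/-- On `V₊ ∩ H`: `R₊ = y₀` (the two square roots of `cornerUnbend` satisfy `2 y₀ y₁ = x₀` and
`y₁ = P₊ > 0`). [cite: DouadyHerault1973, Appendice] -/
theorem unbendR_one_eq {x : 𝔼⁴} (hx : x ∈ unbendDom 1) (h0 : 0 ≤ x 0) :
    unbendR 1 x = cornerUnbend x 0 := by
  have hP := unbendP_pos hx
  have h2 : 2 * cornerUnbend x 0 * cornerUnbend x 1 = x 0 := by
    simpa using congrArg (· 0) (cornerFold_cornerUnbend h0)
  rw [← unbendP_one] at h2
  rw [unbendR, ← h2]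
  field_simp

/-- On `V₋ ∩ H`: `R₋ = y₁`. [cite: DouadyHerault1973, Appendice] -/
theorem unbendR_neg_one_eq {x : 𝔼⁴} (hx : x ∈ unbendDom (-1)) (h0 : 0 ≤ x 0) :
    unbendR (-1) x = cornerUnbend x 1 := by
  have hP := unbendP_pos hx
  have h2 : 2 * cornerUnbend x 0 * cornerUnbend x 1 = x 0 := by
    simpa using congrArg (· 0) (cornerFold_cornerUnbend h0)
  rw [← unbendP_neg_one] at h2
  rw [unbendR, ← h2]
  field_simp

/-- **The smooth continuation `cornerUnbend₊` of `cornerUnbend` to `V₊`**: `(R₊, P₊, x₂, x₃)`.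
[cite: DouadyHerault1973, Appendice] -/
def cornerUnbendPos (x : 𝔼⁴) : 𝔼⁴ := !₂[unbendR 1 x, unbendP 1 x, x 2, x 3]

/-- **The smooth continuation `cornerUnbend₋` of `cornerUnbend` to `V₋`**: `(P₋, R₋, x₂, x₃)`.
[cite: DouadyHerault1973, Appendice] -/
def cornerUnbendNeg (x : 𝔼⁴) : 𝔼⁴ := !₂[unbendP (-1) x, unbendR (-1) x, x 2, x 3]

/-- Coordinate `0` of `cornerUnbendPos`. [folklore] -/
@[simp] theorem cornerUnbendPos_apply_zero (x : 𝔼⁴) : cornerUnbendPos x 0 = unbendR 1 x := rfl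
/-- Coordinate `1` of `cornerUnbendPos`. [folklore] -/
@[simp] theorem cornerUnbendPos_apply_one (x : 𝔼⁴) : cornerUnbendPos x 1 = unbendP 1 x := rfl
/-- Coordinate `2` of `cornerUnbendPos`. [folklore] -/
@[simp] theorem cornerUnbendPos_apply_two (x : 𝔼⁴) : cornerUnbendPos x 2 = x 2 := rfl
/-- Coordinate `3` of `cornerUnbendPos`. [folklore] -/
@[simp] theorem cornerUnbendPos_apply_three (x : 𝔼⁴) : cornerUnbendPos x 3 = x 3 := rfl
/-- Coordinate `0` of `cornerUnbendNeg`. [folklore] -/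
@[simp] theorem cornerUnbendNeg_apply_zero (x : 𝔼⁴) : cornerUnbendNeg x 0 = unbendP (-1) x := rfl
/-- Coordinate `1` of `cornerUnbendNeg`. [folklore] -/
@[simp] theorem cornerUnbendNeg_apply_one (x : 𝔼⁴) : cornerUnbendNeg x 1 = unbendR (-1) x := rfl
/-- Coordinate `2` of `cornerUnbendNeg`. [folklore] -/
@[simp] theorem cornerUnbendNeg_apply_two (x : 𝔼⁴) : cornerUnbendNeg x 2 = x 2 := rfl
/-- Coordinate `3` of `cornerUnbendNeg`. [folklore] -/
@[simp] theorem cornerUnbendNeg_apply_three (x : 𝔼⁴) : cornerUnbendNeg x 3 = x 3 := rfl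

/-- `cornerUnbendPos` is smooth on the open set `V₊`. [cite: DouadyHerault1973, Appendice] -/
theorem contDiffOn_cornerUnbendPos : ContDiffOn ℝ ∞ cornerUnbendPos (unbendDom 1) := by
  rw [contDiffOn_euclidean]
  intro i
  fin_cases i
  · exact contDiffOn_unbendR (Or.inl rfl)
  · exact contDiffOn_unbendP (Or.inl rfl)
  · exact (contDiff_coord 2).contDiffOn
  · exact (contDiff_coord 3).contDiffOn

/-- `cornerUnbendNeg` is smooth on the open set `V₋`. [cite: DouadyHerault1973, Appendice] -/
theorem contDiffOn_cornerUnbendNeg : ContDiffOn ℝ ∞ cornerUnbendNeg (unbendDom (-1)) := by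
  rw [contDiffOn_euclidean]
  intro i
  fin_cases i
  · exact contDiffOn_unbendP (Or.inr rfl)
  · exact contDiffOn_unbendR (Or.inr rfl)
  · exact (contDiff_coord 2).contDiffOn
  · exact (contDiff_coord 3).contDiffOn

/-- `cornerUnbendPos` is smooth at every point of `V₊`. [cite: DouadyHerault1973, Appendice] -/
theorem contDiffAt_cornerUnbendPos {x : 𝔼⁴} (hx : x ∈ unbendDom 1) :
    ContDiffAt ℝ ∞ cornerUnbendPos x :=
  contDiffOn_cornerUnbendPos.contDiffAt ((isOpen_unbendDom 1).mem_nhds hx)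

/-- `cornerUnbendNeg` is smooth at every point of `V₋`. [cite: DouadyHerault1973, Appendice] -/
theorem contDiffAt_cornerUnbendNeg {x : 𝔼⁴} (hx : x ∈ unbendDom (-1)) :
    ContDiffAt ℝ ∞ cornerUnbendNeg x :=
  contDiffOn_cornerUnbendNeg.contDiffAt ((isOpen_unbendDom (-1)).mem_nhds hx)

/-- On `V₊ ∩ H` the continuation agrees with `cornerUnbend`. [cite: DouadyHerault1973, Appendice] -/
theorem cornerUnbendPos_eq_cornerUnbend {x : 𝔼⁴} (hx : x ∈ unbendDom 1) (h0 : 0 ≤ x 0) :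
    cornerUnbendPos x = cornerUnbend x := by
  ext i
  fin_cases i
  · exact unbendR_one_eq hx h0
  · exact unbendP_one x
  · rfl
  · rfl

/-- On `V₋ ∩ H` the continuation agrees with `cornerUnbend`. [cite: DouadyHerault1973, Appendice] -/
theorem cornerUnbendNeg_eq_cornerUnbend {x : 𝔼⁴} (hx : x ∈ unbendDom (-1)) (h0 : 0 ≤ x 0) :
    cornerUnbendNeg x = cornerUnbend x := by
  ext i
  fin_cases i
  · exact unbendP_neg_one x
  · exact unbendR_neg_one_eq hx h0
  · rfl
  · rfl

/-- `cornerFold ∘ cornerUnbendPos = id` on all of `V₊` (not only on the half-space).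
[cite: DouadyHerault1973, Appendice] -/
theorem cornerFold_cornerUnbendPos {x : 𝔼⁴} (hx : x ∈ unbendDom 1) :
    cornerFold (cornerUnbendPos x) = x := by
  ext i
  fin_cases i
  · show cornerFold (cornerUnbendPos x) 0 = x 0
    rw [cornerFold_apply_zero, cornerUnbendPos_apply_zero, cornerUnbendPos_apply_one,
      ← two_mul_unbendP_mul_unbendR hx]
    ring
  · show cornerFold (cornerUnbendPos x) 1 = x 1
    rw [cornerFold_apply_one, cornerUnbendPos_apply_zero, cornerUnbendPos_apply_one,
      unbendP_sq_sub_unbendR_sq (Or.inl rfl) hx, one_mul]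
  · rfl
  · rfl

/-- `cornerFold ∘ cornerUnbendNeg = id` on all of `V₋`. [cite: DouadyHerault1973, Appendice] -/
theorem cornerFold_cornerUnbendNeg {x : 𝔼⁴} (hx : x ∈ unbendDom (-1)) :
    cornerFold (cornerUnbendNeg x) = x := by
  ext i
  fin_cases i
  · show cornerFold (cornerUnbendNeg x) 0 = x 0
    rw [cornerFold_apply_zero, cornerUnbendNeg_apply_zero, cornerUnbendNeg_apply_one,
      ← two_mul_unbendP_mul_unbendR hx]
  · show cornerFold (cornerUnbendNeg x) 1 = x 1
    rw [cornerFold_apply_one, cornerUnbendNeg_apply_zero, cornerUnbendNeg_apply_one]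
    have := unbendP_sq_sub_unbendR_sq (Or.inr rfl) hx
    linarith
  · rfl
  · rfl

/-- The open half `{y₁ > 0}` is folded into `V₊`: `ρ + x₁ = 2 y₁² > 0`. [cite: DouadyHerault1973, Appendice] -/
theorem cornerFold_mem_unbendDom_one {y : 𝔼⁴} (hy : 0 < y 1) : cornerFold y ∈ unbendDom 1 := by
  rw [mem_unbendDom_iff, cornerRadius_cornerFold, cornerFold_apply_one]
  nlinarith [sq_nonneg (y 0)]

/-- The open half `{y₀ > 0}` is folded into `V₋`: `ρ - x₁ = 2 y₀² > 0`. [cite: DouadyHerault1973, Appendice] -/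
theorem cornerFold_mem_unbendDom_neg_one {y : 𝔼⁴} (hy : 0 < y 0) : cornerFold y ∈ unbendDom (-1) := by
  rw [mem_unbendDom_iff, cornerRadius_cornerFold, cornerFold_apply_one]
  nlinarith [sq_nonneg (y 1)]

/-- `P₊(cornerFold y) = y₁` for `y₁ ≥ 0`. [folklore] -/
theorem unbendP_one_cornerFold {y : 𝔼⁴} (hy : 0 ≤ y 1) : unbendP 1 (cornerFold y) = y 1 := by
  rw [unbendP, cornerRadius_cornerFold, cornerFold_apply_one,
    show (y 0 ^ 2 + y 1 ^ 2 + 1 * (y 1 ^ 2 - y 0 ^ 2)) / 2 = y 1 ^ 2 by ring, Real.sqrt_sq hy]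

/-- `P₋(cornerFold y) = y₀` for `y₀ ≥ 0`. [folklore] -/
theorem unbendP_neg_one_cornerFold {y : 𝔼⁴} (hy : 0 ≤ y 0) : unbendP (-1) (cornerFold y) = y 0 := by
  rw [unbendP, cornerRadius_cornerFold, cornerFold_apply_one,
    show (y 0 ^ 2 + y 1 ^ 2 + -1 * (y 1 ^ 2 - y 0 ^ 2)) / 2 = y 0 ^ 2 by ring, Real.sqrt_sq hy]

/-- `cornerUnbendPos ∘ cornerFold = id` on `{y₁ > 0}`. [cite: DouadyHerault1973, Appendice] -/
theorem cornerUnbendPos_cornerFold {y : 𝔼⁴} (hy : 0 < y 1) : cornerUnbendPos (cornerFold y) = y := by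
  have hP : unbendP 1 (cornerFold y) = y 1 := unbendP_one_cornerFold hy.le
  ext i
  fin_cases i
  · show unbendR 1 (cornerFold y) = y 0
    rw [unbendR, hP, cornerFold_apply_zero]
    field_simp
  · exact hP
  · rfl
  · rfl

/-- `cornerUnbendNeg ∘ cornerFold = id` on `{y₀ > 0}`. [cite: DouadyHerault1973, Appendice] -/
theorem cornerUnbendNeg_cornerFold {y : 𝔼⁴} (hy : 0 < y 0) : cornerUnbendNeg (cornerFold y) = y := by
  have hP : unbendP (-1) (cornerFold y) = y 0 := unbendP_neg_one_cornerFold hy.le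
  ext i
  fin_cases i
  · exact hP
  · show unbendR (-1) (cornerFold y) = y 1
    rw [unbendR, hP, cornerFold_apply_zero]
    field_simp
  · rfl
  · rfl

/-- `cornerUnbendPos` maps `V₊` into `{y₁ > 0}`. [folklore] -/
theorem cornerUnbendPos_apply_one_pos {x : 𝔼⁴} (hx : x ∈ unbendDom 1) : 0 < cornerUnbendPos x 1 :=
  unbendP_pos hx

/-- `cornerUnbendNeg` maps `V₋` into `{y₀ > 0}`. [folklore] -/
theorem cornerUnbendNeg_apply_zero_pos {x : 𝔼⁴} (hx : x ∈ unbendDom (-1)) : 0 < cornerUnbendNeg x 0 :=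
  unbendP_pos hx

/-- **`cornerFold` is a diffeomorphism from `{y₁ > 0}` onto `V₊`**, packaged as an open partial
homeomorphism of `ℝ⁴` with inverse `cornerUnbendPos` (both maps are `C^∞` on the respective
open sets: `contDiff_cornerFold`, `contDiffOn_cornerFoldPosChart_symm`).
[cite: DouadyHerault1973, Appendice] -/
def cornerFoldPosChart : OpenPartialHomeomorph 𝔼⁴ 𝔼⁴ where
  toFun := cornerFold
  invFun := cornerUnbendPos
  source := {y | 0 < y 1}
  target := unbendDom 1
  map_source' _ hy := cornerFold_mem_unbendDom_one hy
  map_target' _ hx := cornerUnbendPos_apply_one_pos hx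
  left_inv' _ hy := cornerUnbendPos_cornerFold hy
  right_inv' _ hx := cornerFold_cornerUnbendPos hx
  open_source := isOpen_lt continuous_const (continuous_coord 1)
  open_target := isOpen_unbendDom 1
  continuousOn_toFun := continuous_cornerFold.continuousOn
  continuousOn_invFun := contDiffOn_cornerUnbendPos.continuousOn

/-- **`cornerFold` is a diffeomorphism from `{y₀ > 0}` onto `V₋`**, with inverse `cornerUnbendNeg`.
[cite: DouadyHerault1973, Appendice] -/
def cornerFoldNegChart : OpenPartialHomeomorph 𝔼⁴ 𝔼⁴ where
  toFun := cornerFold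
  invFun := cornerUnbendNeg
  source := {y | 0 < y 0}
  target := unbendDom (-1)
  map_source' _ hy := cornerFold_mem_unbendDom_neg_one hy
  map_target' _ hx := cornerUnbendNeg_apply_zero_pos hx
  left_inv' _ hy := cornerUnbendNeg_cornerFold hy
  right_inv' _ hx := cornerFold_cornerUnbendNeg hx
  open_source := isOpen_lt continuous_const (continuous_coord 0)
  open_target := isOpen_unbendDom (-1)
  continuousOn_toFun := continuous_cornerFold.continuousOn
  continuousOn_invFun := contDiffOn_cornerUnbendNeg.continuousOn

/-- `cornerFoldPosChart` is `cornerFold` on points. [folklore] -/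
@[simp] theorem cornerFoldPosChart_apply (y : 𝔼⁴) : cornerFoldPosChart y = cornerFold y := rfl
/-- The inverse of `cornerFoldPosChart` is `cornerUnbendPos` on points. [folklore] -/
@[simp] theorem cornerFoldPosChart_symm_apply (x : 𝔼⁴) :
    cornerFoldPosChart.symm x = cornerUnbendPos x := rfl
/-- Source of `cornerFoldPosChart`. [folklore] -/
theorem cornerFoldPosChart_source : cornerFoldPosChart.source = {y : 𝔼⁴ | 0 < y 1} := rfl
/-- Target of `cornerFoldPosChart`. [folklore] -/
theorem cornerFoldPosChart_target : cornerFoldPosChart.target = unbendDom 1 := rfl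
/-- `cornerFoldNegChart` is `cornerFold` on points. [folklore] -/
@[simp] theorem cornerFoldNegChart_apply (y : 𝔼⁴) : cornerFoldNegChart y = cornerFold y := rfl
/-- The inverse of `cornerFoldNegChart` is `cornerUnbendNeg` on points. [folklore] -/
@[simp] theorem cornerFoldNegChart_symm_apply (x : 𝔼⁴) :
    cornerFoldNegChart.symm x = cornerUnbendNeg x := rfl
/-- Source of `cornerFoldNegChart`. [folklore] -/
theorem cornerFoldNegChart_source : cornerFoldNegChart.source = {y : 𝔼⁴ | 0 < y 0} := rfl
/-- Target of `cornerFoldNegChart`. [folklore] -/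
theorem cornerFoldNegChart_target : cornerFoldNegChart.target = unbendDom (-1) := rfl

/-- `cornerFoldPosChart` is `C^∞` on its source. [cite: DouadyHerault1973, Appendice] -/
theorem contDiffOn_cornerFoldPosChart :
    ContDiffOn ℝ ∞ cornerFoldPosChart cornerFoldPosChart.source :=
  contDiff_cornerFold.contDiffOn

/-- The inverse of `cornerFoldPosChart` is `C^∞` on its source `V₊`. [cite: DouadyHerault1973, Appendice] -/
theorem contDiffOn_cornerFoldPosChart_symm :
    ContDiffOn ℝ ∞ cornerFoldPosChart.symm cornerFoldPosChart.target :=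
  contDiffOn_cornerUnbendPos

/-- `cornerFoldNegChart` is `C^∞` on its source. [cite: DouadyHerault1973, Appendice] -/
theorem contDiffOn_cornerFoldNegChart :
    ContDiffOn ℝ ∞ cornerFoldNegChart cornerFoldNegChart.source :=
  contDiff_cornerFold.contDiffOn

/-- The inverse of `cornerFoldNegChart` is `C^∞` on its source `V₋`. [cite: DouadyHerault1973, Appendice] -/
theorem contDiffOn_cornerFoldNegChart_symm :
    ContDiffOn ℝ ∞ cornerFoldNegChart.symm cornerFoldNegChart.target :=
  contDiffOn_cornerUnbendNeg

/-- `cornerFold` is injective on `{y₁ > 0}` (in addition to the quadrant).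
[cite: DouadyHerault1973, Appendice] -/
theorem cornerFold_injOn_pos : InjOn cornerFold {y : 𝔼⁴ | 0 < y 1} :=
  cornerFoldPosChart.injOn

/-- `cornerFold` is injective on `{y₀ > 0}`. [cite: DouadyHerault1973, Appendice] -/
theorem cornerFold_injOn_neg : InjOn cornerFold {y : 𝔼⁴ | 0 < y 0} :=
  cornerFoldNegChart.injOn

/-! ### Smoothness of `cornerUnbend` itself off the corner stratum -/

/-- **`cornerUnbend` is `C^∞` at every point with `x₀ ≠ 0`** (both radicands `(ρ ∓ x₁)/2` are
positive there). [cite: DouadyHerault1973, Appendice] -/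
theorem contDiffAt_cornerUnbend {x : 𝔼⁴} (h : x 0 ≠ 0) : ContDiffAt ℝ ∞ cornerUnbend x := by
  have hlt := abs_apply_one_lt_cornerRadius h
  have hρ : ContDiffAt ℝ ∞ cornerRadius x := contDiffAt_cornerRadius (Or.inl h)
  have h1 : ContDiffAt ℝ ∞ (fun x : 𝔼⁴ => x 1) x := (contDiff_coord 1).contDiffAt
  rw [contDiffAt_euclidean]
  intro i
  fin_cases i
  · refine ((hρ.sub h1).div_const 2).sqrt ?_
    have : 0 < (cornerRadius x - x 1) / 2 := by linarith [le_abs_self (x 1)]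
    exact this.ne'
  · refine ((hρ.add h1).div_const 2).sqrt ?_
    have : 0 < (cornerRadius x + x 1) / 2 := by linarith [neg_abs_le (x 1)]
    exact this.ne'
  · exact (contDiff_coord 2).contDiffAt
  · exact (contDiff_coord 3).contDiffAt

/-- **`cornerUnbend` is `C^∞` within the half-space at every point of `H` off the corner
stratum**: near such a point it agrees on `H` with `cornerUnbendPos` or `cornerUnbendNeg`.
[cite: DouadyHerault1973, Appendice] -/
theorem contDiffWithinAt_cornerUnbend {x : 𝔼⁴} (h0 : 0 ≤ x 0) (h : x 0 ≠ 0 ∨ x 1 ≠ 0) :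
    ContDiffWithinAt ℝ ∞ cornerUnbend {x : 𝔼⁴ | 0 ≤ x 0} x := by
  rcases mem_unbendDom_or h with hx | hx
  · refine (contDiffAt_cornerUnbendPos hx).contDiffWithinAt.congr_of_eventuallyEq ?_
      (cornerUnbendPos_eq_cornerUnbend hx h0).symm
    have hmem : unbendDom 1 ∈ 𝓝[{x : 𝔼⁴ | 0 ≤ x 0}] x :=
      mem_nhdsWithin_of_mem_nhds ((isOpen_unbendDom 1).mem_nhds hx)
    filter_upwards [hmem, self_mem_nhdsWithin] with z hz hz0
    exact (cornerUnbendPos_eq_cornerUnbend hz hz0).symm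
  · refine (contDiffAt_cornerUnbendNeg hx).contDiffWithinAt.congr_of_eventuallyEq ?_
      (cornerUnbendNeg_eq_cornerUnbend hx h0).symm
    have hmem : unbendDom (-1) ∈ 𝓝[{x : 𝔼⁴ | 0 ≤ x 0}] x :=
      mem_nhdsWithin_of_mem_nhds ((isOpen_unbendDom (-1)).mem_nhds hx)
    filter_upwards [hmem, self_mem_nhdsWithin] with z hz hz0
    exact (cornerUnbendNeg_eq_cornerUnbend hz hz0).symm

/-- `cornerUnbend` is `C^∞` on the half-space minus the corner stratum.
[cite: DouadyHerault1973, Appendice] -/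
theorem contDiffOn_cornerUnbend :
    ContDiffOn ℝ ∞ cornerUnbend ({x : 𝔼⁴ | 0 ≤ x 0} ∩ {x | x 0 ≠ 0 ∨ x 1 ≠ 0}) :=
  fun _ hx => (contDiffWithinAt_cornerUnbend hx.1 hx.2).mono inter_subset_left

/-- `cornerUnbend` is `C^∞` on the open half-space `{x₀ > 0}`. [cite: DouadyHerault1973, Appendice] -/
theorem contDiffOn_cornerUnbend_pos : ContDiffOn ℝ ∞ cornerUnbend {x : 𝔼⁴ | 0 < x 0} :=
  fun _ hx => (contDiffAt_cornerUnbend (ne_of_gt hx)).contDiffWithinAt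

/-- The open quadrant is folded exactly onto the open half-space `{x₀ > 0}` (on which
`cornerFold` is therefore a diffeomorphism with inverse `cornerUnbend`, by `cornerFold_injOn`,
`contDiff_cornerFold` and `contDiffOn_cornerUnbend_pos`). [cite: DouadyHerault1973, Appendice] -/
theorem image_cornerFold_pos_quadrant :
    cornerFold '' {y : 𝔼⁴ | 0 < y 0 ∧ 0 < y 1} = {x : 𝔼⁴ | 0 < x 0} := by
  refine Subset.antisymm ?_ fun x hx => ?_
  · rintro _ ⟨y, hy, rfl⟩
    exact (cornerFold_apply_zero_pos_iff ⟨hy.1.le, hy.2.le⟩).2 hy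
  · have hx0 : 0 ≤ x 0 := le_of_lt hx
    exact ⟨cornerUnbend x, (cornerUnbend_pos_iff hx0).2 hx, cornerFold_cornerUnbend hx0⟩

end Literature.Topology.FourManifolds

end
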